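import Summits.QuantumFields.YangMills.Theorems.BalabanUVNodesN15TwoSpacingGluingAdjointDefectGluingCutOut
import Summits.QuantumFields.YangMills.Theorems.BalabanUVNodesN15CurvedGluingLocalGauges
import HarnessLib

/-!
# THE ADJOINT GLUING ACROSS PER-CUBE GAUGES (dag-n15-w2 `…CurvedGluingLocalGauges` transposed): FILE 158's entry-2 theorem and FILE 147's two-sided inverse for the conjugated-back family
# `G_k := M_{W_kᵀ}X_kM_{W_k}` with every per-cube row ∕ identity given IN THE CUBE's GAUGE — cut rows, OUTPUT-localized adjoint commutator rows `X_k∘[Δ^{W_k}, M_{h_k}]`, the sandwich of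
# `X_k` against the conjugated right entry `M_{W_k}EM_{W_kᵀ}`, the right-locality identity `X_k∘Δ^{W_k}∘M_{h_k} = M_{h_k} + Ẽ_k` (dag-n15-c g18, FILE 160; N15 = NE2, s1 «background-layer OPERATOR ingredient»)

Cell `pub-ymgap`, seat `pub-ymgap-dag-n15-c` (R134 (a); HUMAN RULING D-0062), generation 18.  `bears_on: R4∕N15 · K3⁸ SpineGivenEndpointR13SepCoPHV (stmt-QuantumFields-27366)`.
Filed `--kind proof --supports stmt-QuantumFields-27366 --as helper` — COUNT-NEUTRAL.  Theorems only; 0 `def`, 0 `sorry`.  Imports BY NAME FILE 158 `…AdjointDefectGluingCutOut`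
(`hasMaj_glueInvL_parametrix_comp_cut_of_defect_out`, `hasMaj_remainderLD_out`; through it FILE 147 `glued_adjoint_inverse_of_defect`) and dag-n15-w2 `…CurvedGluingLocalGauges`
(`cutRow_of_localGauge`, `localOp_conj_back`; through it dag-n15-w3 `…CubeDressedGeneralGauge`: `comp_commOp_gaugeConj`, `hasMaj_gaugeConj_back`, `gaugeConj_comp_gaugeConj`,
`gaugeConj_comp_mulOp`, `gaugeConj_add`, `gaugeConj_mulOp_site`, `mulOp_fst_comm_mmulOp`, `mmulOp_transpose_comp`).  Nothing in the tree is modified; nothing restated.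

WHY.  [B9] (3.34)–(3.35): the background is small only CUBE BY CUBE, each cube propagator is computed in its own gauge `u_k` and conjugated back by `W_k = Ad_{u_k}`.  dag-n15-w2's file did this
for the DIRECT gluing (rows `[Δ, M_h]∘G`); the adjoint arrangement of entry 2 (FILES 147–159) needs the transposed transfer: `(M_{Wᵀ}XM_W)∘[Δ, M_h] = M_{Wᵀ}∘(X∘[Δ^W, M_h])∘M_W`
(`comp_commOp_gaugeConj`), the sandwich of the conjugated cube against a GLOBAL right entry `E` read through the cube-gauge sandwich against `E^{W} = M_WEM_{Wᵀ}`, and the right-locality identity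
conjugated back.  Rows pick up `|κ|²` (orthogonal site matrices have entries `≤ 1`).

WHAT.  §1 transfer lemmas `commRowR_of_localGauge`, `sandwichR_of_localGauge`, `sandwichRow_of_localGauge`, `defectRow₂_of_localGauge`, `hlocR_defect_glue_of_localGauge`; §2 ★★★
`hasMaj_gluedL_comp_of_localGauges` (FILE 158 ★★ for the conjugated-back family: `glueInvL (R̃ − Σ_kM_{h_k}Ẽ_k) (Σ_kM_{h_k}G_kM_{h_k}) ∘ E ≤ (1 − N_ov|κ|²(θ₀+ε)c_r)⁻¹·N_ov|κ|²(β₂c_s + βc_d)·c_r·e^{−(δ−2σ)d}`),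
★★★ `gluedL_inverse_of_localGauges` (`𝒢∘Δ = 1 ∧ Δ∘𝒢 = 1`).

HONEST FRAMING ∕ LIMITS.  Conjugation algebra + block-majorant bookkeeping over DISPLAYED letters; proves NO estimate of any concrete propagator; nothing of [B5]∕[B6]∕[B9] asserted ((3.34)–(3.35)
p.396, (3.42) p.397, (3.87) p.409, (2.91)–(2.93) p.239, (2.133)–(2.136) p.247 = SHAPES ∕ MECHANISM).  NE2⁺ NOT PRINTED, NOT proved; N15 NOT discharged; K3⁸ OPEN, skeleton v7 untouched (0∕2);
counts of record UNMOVED by this seat (typed 28∕28 · discharged 7∕28 = 7∕27 excl. NODE O, №245); one finite 𝕋⁴ at fixed ε — NOT infinite volume, NOT OS on ℝ⁴, NOT a mass gap, NOT Clay; R4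
closes the conditional finite-𝕋⁴ rung `BalabanLadder.UV` only.  Restate-immune (no Theses import).
-/

set_option autoImplicit false

noncomputable section
open scoped BigOperators Matrix
open Finset

namespace Summit.QuantumFields.YangMills.BalabanUVNodes.N15.Gluing

open Literature.MathematicalPhysics.QuantumFieldTheory.Balaban1983to89
open Literature.MathematicalPhysics.QuantumFieldTheory.Balaban1983to89.B11SectG (BlockNorm HasMaj RowSum)
open Literature.MathematicalPhysics.QuantumFieldTheory.Balaban1983to89.B6RandomWalk (Triangle254)
open Literature.MathematicalPhysics.QuantumFieldTheory.Balaban1983to89.B6Prop26Gluing (mulOp ind ind_nonneg)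
open Summit.QuantumFields.YangMills.BalabanUVNodes.N15.MatrixSpecies (mmulOp liftBlk)
open Summit.QuantumFields.YangMills.BalabanUVNodes.N15.CurvedSpecies (cutRow_of_localGauge localOp_conj_back comp_commOp_gaugeConj hasMaj_gaugeConj_back gaugeConj_comp_gaugeConj
  gaugeConj_comp_mulOp gaugeConj_add gaugeConj_mulOp_site mulOp_fst_comm_mmulOp mmulOp_transpose_comp mmulOp_comp_transpose mmulOp_transpose_comp_cancel)

variable {X : Type} [Fintype X] [DecidableEq X] {κ : Type} [Fintype κ] [DecidableEq κ] {K : Type} [Fintype K] {g : B6.Geometry} (blk : X → g.Site) (S : K → Set g.Site)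
  (W : K → X → Matrix κ κ ℝ) (Δ E : (X × κ → ℝ) →ₗ[ℝ] (X × κ → ℝ)) (hX χX hs : K → X → ℝ) (G' T' E' : K → (X × κ → ℝ) →ₗ[ℝ] (X × κ → ℝ))

/-! ## §1 The adjoint-side row families and identities transfer from the cubes' gauges to the global gauge -/

section Rows

omit [DecidableEq X] [Fintype K] in
/-- ★★ **ADJOINT COMMUTATOR ROWS TRANSFER**: `(M_{Wᵀ}G′M_W)∘[Δ, M_h]` IS `M_{Wᵀ}∘(G′∘[Δ^W, M_h])∘M_W` (`Δ = M_{Wᵀ}Δ^WM_W`; dag-n15-w3 `comp_commOp_gaugeConj`), so the cube-gauge OUTPUT-localized row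
`G′∘[Δ^W, M_h] ≤ 1_S(y)·θ₀e^{−δd}` gives the global one with `|κ|²θ₀`. [cite: Balaban1984PropagatorsII, (2.93) p.239 (shape, transposed); Balaban1985BackgroundPropagators, (3.34) p.396] -/
theorem commRowR_of_localGauge (hW : ∀ k x, W k x * (W k x)ᵀ = 1) (hW' : ∀ k x, (W k x)ᵀ * W k x = 1) {θ₀ δ : ℝ} (hθ : 0 ≤ θ₀) (k : K)
    (hK' : HasMaj (BlockNorm.ofBlocks g (liftBlk blk κ)) (BlockNorm.ofBlocks g (liftBlk blk κ))
      (G' k ∘ₗ commOp (mmulOp (W k) ∘ₗ Δ ∘ₗ mmulOp (fun x => (W k x)ᵀ)) (fun p : X × κ => hX k p.1)) (fun y y' => ind (S k) y * (θ₀ * Real.exp (-(δ * g.dist y y'))))) :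
    HasMaj (BlockNorm.ofBlocks g (liftBlk blk κ)) (BlockNorm.ofBlocks g (liftBlk blk κ))
      ((mmulOp (fun x => (W k x)ᵀ) ∘ₗ G' k ∘ₗ mmulOp (W k)) ∘ₗ commOp Δ (fun p : X × κ => hX k p.1))
      (fun y y' => ind (S k) y * ((Fintype.card κ : ℝ) ^ 2 * θ₀ * Real.exp (-(δ * g.dist y y')))) := by
  have hV' : ∀ x, ((W k x)ᵀ)ᵀ * (W k x)ᵀ = 1 := fun x => by rw [Matrix.transpose_transpose]; exact hW k x
  have e := comp_commOp_gaugeConj (fun x => (W k x)ᵀ) hV' (hX k) (mmulOp (W k) ∘ₗ Δ ∘ₗ mmulOp (fun x => (W k x)ᵀ)) (G' k)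
  simp only [Matrix.transpose_transpose] at e
  rw [show (fun x => W k x) = W k from rfl, localOp_conj_back W Δ hW' k] at e
  rw [e]
  refine (hasMaj_gaugeConj_back blk (W k) (hW k) (hW' k) (fun y y' => ?_) hK').mono fun y y' => le_of_eq (by ring)
  exact mul_nonneg (ind_nonneg _ y) (mul_nonneg hθ (Real.exp_nonneg _))

omit [Fintype X] [DecidableEq X] [Fintype K] in
/-- ★★ **THE SANDWICH TRANSFERS**: the cube-gauge sandwich of `G′` against the conjugated right entry `E^W = M_WEM_{Wᵀ}`, `M_χ∘G′∘E^W∘M_{h^s} = T′∘M_{h^s}`, gives the global one for the conjugated-back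
cube: `M_χ∘(M_{Wᵀ}G′M_W)∘E∘M_{h^s} = (M_{Wᵀ}T′M_W)∘M_{h^s}` (`WᵀW = 1`; site multipliers commute with the gauge action). [cite: Balaban1985BackgroundPropagators, (3.34)–(3.35) p.396, (3.42) p.397 (shapes)] -/
theorem sandwichR_of_localGauge (hW' : ∀ k x, (W k x)ᵀ * W k x = 1) (k : K)
    (hE2' : mulOp (fun p : X × κ => χX k p.1) ∘ₗ G' k ∘ₗ (mmulOp (W k) ∘ₗ E ∘ₗ mmulOp (fun x => (W k x)ᵀ)) ∘ₗ mulOp (fun p : X × κ => hs k p.1) = T' k ∘ₗ mulOp (fun p : X × κ => hs k p.1)) :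
    mulOp (fun p : X × κ => χX k p.1) ∘ₗ (mmulOp (fun x => (W k x)ᵀ) ∘ₗ G' k ∘ₗ mmulOp (W k)) ∘ₗ E ∘ₗ mulOp (fun p : X × κ => hs k p.1) =
      (mmulOp (fun x => (W k x)ᵀ) ∘ₗ T' k ∘ₗ mmulOp (W k)) ∘ₗ mulOp (fun p : X × κ => hs k p.1) := by
  -- insert `WᵀW = 1` after `E` and move `M_{h^s}`, `M_χ` through the gauge action
  have key : mmulOp (fun x => (W k x)ᵀ) ∘ₗ ((mulOp (fun p : X × κ => χX k p.1) ∘ₗ G' k ∘ₗ (mmulOp (W k) ∘ₗ E ∘ₗ mmulOp (fun x => (W k x)ᵀ)) ∘ₗ mulOp (fun p : X × κ => hs k p.1)) ∘ₗ mmulOp (W k)) =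
      mulOp (fun p : X × κ => χX k p.1) ∘ₗ (mmulOp (fun x => (W k x)ᵀ) ∘ₗ G' k ∘ₗ mmulOp (W k)) ∘ₗ E ∘ₗ mulOp (fun p : X × κ => hs k p.1) := by
    simp only [LinearMap.comp_assoc]
    rw [mulOp_fst_comm_mmulOp, mmulOp_transpose_comp_cancel (W k) (hW' k),
      ← LinearMap.comp_assoc (g := mmulOp (fun x => (W k x)ᵀ)) (h := mulOp (fun p : X × κ => χX k p.1)), mulOp_fst_comm_mmulOp, LinearMap.comp_assoc]
  rw [← key, hE2']
  simp only [LinearMap.comp_assoc]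
  rw [mulOp_fst_comm_mmulOp]

omit [DecidableEq X] [Fintype K] in
/-- ★ **THE SANDWICHED OPERATOR's ROW TRANSFERS**: `T′ ≤ 1_S1_S·β₂e^{−δd}` ⟹ `M_{Wᵀ}T′M_W ≤ 1_S1_S·|κ|²β₂·e^{−δd}`. [cite: Balaban1985BackgroundPropagators, (3.34)–(3.35) p.396 (shapes)] -/
theorem sandwichRow_of_localGauge (hW : ∀ k x, W k x * (W k x)ᵀ = 1) (hW' : ∀ k x, (W k x)ᵀ * W k x = 1) {β₂ δ : ℝ} (hβ₂ : 0 ≤ β₂) (k : K)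
    (hT' : HasMaj (BlockNorm.ofBlocks g (liftBlk blk κ)) (BlockNorm.ofBlocks g (liftBlk blk κ)) (T' k) (fun y y' => ind (S k) y * ind (S k) y' * (β₂ * Real.exp (-(δ * g.dist y y'))))) :
    HasMaj (BlockNorm.ofBlocks g (liftBlk blk κ)) (BlockNorm.ofBlocks g (liftBlk blk κ)) (mmulOp (fun x => (W k x)ᵀ) ∘ₗ T' k ∘ₗ mmulOp (W k))
      (fun y y' => ind (S k) y * ind (S k) y' * ((Fintype.card κ : ℝ) ^ 2 * β₂ * Real.exp (-(δ * g.dist y y')))) := by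
  refine (hasMaj_gaugeConj_back blk (W k) (hW k) (hW' k) (fun y y' => ?_) hT').mono fun y y' => le_of_eq (by ring)
  exact mul_nonneg (mul_nonneg (ind_nonneg _ y) (ind_nonneg _ y')) (mul_nonneg hβ₂ (Real.exp_nonneg _))

omit [DecidableEq X] [Fintype K] in
/-- ★ **TWO-SIDED DEFECT ROWS TRANSFER**: `Ẽ′ ≤ 1_S1_S·εe^{−δd}` ⟹ `M_{Wᵀ}Ẽ′M_W ≤ 1_S1_S·|κ|²ε·e^{−δd}`. [cite: Balaban1985BackgroundPropagators, (3.34)–(3.35) p.396 (shapes)] -/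
theorem defectRow₂_of_localGauge (hW : ∀ k x, W k x * (W k x)ᵀ = 1) (hW' : ∀ k x, (W k x)ᵀ * W k x = 1) {ε δ : ℝ} (hε : 0 ≤ ε) (k : K)
    (hE' : HasMaj (BlockNorm.ofBlocks g (liftBlk blk κ)) (BlockNorm.ofBlocks g (liftBlk blk κ)) (E' k) (fun y y' => ind (S k) y * ind (S k) y' * (ε * Real.exp (-(δ * g.dist y y'))))) :
    HasMaj (BlockNorm.ofBlocks g (liftBlk blk κ)) (BlockNorm.ofBlocks g (liftBlk blk κ)) (mmulOp (fun x => (W k x)ᵀ) ∘ₗ E' k ∘ₗ mmulOp (W k))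
      (fun y y' => ind (S k) y * ind (S k) y' * ((Fintype.card κ : ℝ) ^ 2 * ε * Real.exp (-(δ * g.dist y y')))) := by
  refine (hasMaj_gaugeConj_back blk (W k) (hW k) (hW' k) (fun y y' => ?_) hE').mono fun y y' => le_of_eq (by ring)
  exact mul_nonneg (mul_nonneg (ind_nonneg _ y) (ind_nonneg _ y')) (mul_nonneg hε (Real.exp_nonneg _))

omit [Fintype X] [DecidableEq X] [Fintype K] in
/-- ★★ **THE RIGHT-LOCALITY-WITH-DEFECT IDENTITIES TRANSFER**: `G′∘Δ^W∘M_h = M_h + Ẽ′` in the cube's gauge ⟹ `(M_{Wᵀ}G′M_W)∘Δ∘M_h = M_h + M_{Wᵀ}Ẽ′M_W` for the GLOBAL operator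
(`Δ = M_{Wᵀ}Δ^WM_W`, `M_WM_hM_{Wᵀ} = M_h`). [cite: Balaban1985BackgroundPropagators, (3.34)–(3.35) p.396, (3.65) p.403 (shapes); Balaban1984PropagatorsII, (2.91) p.239 (transposed)] -/
theorem hlocR_defect_glue_of_localGauge (hW : ∀ k x, W k x * (W k x)ᵀ = 1) (hW' : ∀ k x, (W k x)ᵀ * W k x = 1) (k : K)
    (hloc' : G' k ∘ₗ (mmulOp (W k) ∘ₗ Δ ∘ₗ mmulOp (fun x => (W k x)ᵀ)) ∘ₗ mulOp (fun p : X × κ => hX k p.1) = mulOp (fun p : X × κ => hX k p.1) + E' k) :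
    (mmulOp (fun x => (W k x)ᵀ) ∘ₗ G' k ∘ₗ mmulOp (W k)) ∘ₗ Δ ∘ₗ mulOp (fun p : X × κ => hX k p.1) =
      mulOp (fun p : X × κ => hX k p.1) + mmulOp (fun x => (W k x)ᵀ) ∘ₗ E' k ∘ₗ mmulOp (W k) := by
  have hV : ∀ x, (W k x)ᵀ * ((W k x)ᵀ)ᵀ = 1 := fun x => by rw [Matrix.transpose_transpose]; exact hW' k x
  have hV' : ∀ x, ((W k x)ᵀ)ᵀ * (W k x)ᵀ = 1 := fun x => by rw [Matrix.transpose_transpose]; exact hW k x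
  -- `Δ∘M_h = M_{Wᵀ}∘(Δ^W∘M_h)∘M_W`
  have hΔ : Δ ∘ₗ mulOp (fun p : X × κ => hX k p.1) = mmulOp (fun x => (W k x)ᵀ) ∘ₗ ((mmulOp (W k) ∘ₗ Δ ∘ₗ mmulOp (fun x => (W k x)ᵀ)) ∘ₗ mulOp (fun p : X × κ => hX k p.1)) ∘ₗ mmulOp (W k) := by
    have e := gaugeConj_comp_mulOp (fun x => (W k x)ᵀ) (hX k) (mmulOp (W k) ∘ₗ Δ ∘ₗ mmulOp (fun x => (W k x)ᵀ))
    simp only [Matrix.transpose_transpose] at e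
    rw [show (fun x => W k x) = W k from rfl, localOp_conj_back W Δ hW' k] at e
    exact e
  have e2 := gaugeConj_comp_gaugeConj (fun x => (W k x)ᵀ) hV' (G' k) ((mmulOp (W k) ∘ₗ Δ ∘ₗ mmulOp (fun x => (W k x)ᵀ)) ∘ₗ mulOp (fun p : X × κ => hX k p.1))
  simp only [Matrix.transpose_transpose] at e2
  rw [show (fun x => W k x) = W k from rfl] at e2
  have e3 := gaugeConj_mulOp_site (fun x => (W k x)ᵀ) hV (hX k)
  simp only [Matrix.transpose_transpose] at e3
  rw [show (fun x => W k x) = W k from rfl] at e3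
  calc (mmulOp (fun x => (W k x)ᵀ) ∘ₗ G' k ∘ₗ mmulOp (W k)) ∘ₗ Δ ∘ₗ mulOp (fun p : X × κ => hX k p.1)
      = (mmulOp (fun x => (W k x)ᵀ) ∘ₗ G' k ∘ₗ mmulOp (W k)) ∘ₗ (mmulOp (fun x => (W k x)ᵀ) ∘ₗ ((mmulOp (W k) ∘ₗ Δ ∘ₗ mmulOp (fun x => (W k x)ᵀ)) ∘ₗ mulOp (fun p : X × κ => hX k p.1)) ∘ₗ mmulOp (W k)) := by
        rw [hΔ]
    _ = mmulOp (fun x => (W k x)ᵀ) ∘ₗ (G' k ∘ₗ ((mmulOp (W k) ∘ₗ Δ ∘ₗ mmulOp (fun x => (W k x)ᵀ)) ∘ₗ mulOp (fun p : X × κ => hX k p.1))) ∘ₗ mmulOp (W k) := e2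
    _ = mmulOp (fun x => (W k x)ᵀ) ∘ₗ (mulOp (fun p : X × κ => hX k p.1) + E' k) ∘ₗ mmulOp (W k) := by rw [hloc']
    _ = mulOp (fun p : X × κ => hX k p.1) + mmulOp (fun x => (W k x)ᵀ) ∘ₗ E' k ∘ₗ mmulOp (W k) := by
        have ea := gaugeConj_add (fun x => (W k x)ᵀ) (mulOp (fun p : X × κ => hX k p.1)) (E' k)
        simp only [Matrix.transpose_transpose] at ea
        rw [show (fun x => W k x) = W k from rfl] at ea
        rw [ea, e3]

end Rows

/-! ## §2 FILE 158's entry-2 theorem and FILE 147's inverse with the cubes given in their own gauges -/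

section Glue

variable {σ cr : ℝ}

/-- ★★★ **ENTRY 2 OF THE ADJOINT GLUED OPERATOR BUILT FROM PER-CUBE-GAUGE CUBES** — FILE 158 `hasMaj_glueInvL_parametrix_comp_cut_of_defect_out` for the conjugated-back family
`G_k := M_{W_kᵀ}G′_kM_{W_k}`, `T₂,k := M_{W_kᵀ}T′_kM_{W_k}`, `Ẽ_k := M_{W_kᵀ}Ẽ′_kM_{W_k}`, all per-cube data IN THE CUBES' GAUGES: cut rows `M_{χ_k}G′_k ≤ 1_S1_S·β`, the sandwich against the
conjugated right entry `M_{χ_k}∘G′_k∘(M_{W_k}EM_{W_kᵀ})∘M_{h^s_k} = T′_k∘M_{h^s_k}` with `T′_k ≤ 1_S1_S·β₂`, OUTPUT-localized adjoint commutator rows `G′_k∘[Δ^{W_k}, M_{h_k}] ≤ 1_S(y)·θ₀`, two-sided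
right-locality defect rows `Ẽ′_k ≤ 1_S1_S·ε`; the GLOBAL `E`'s scalar adjoint Leibniz rule `M_{h_k}∘E = E∘M_{h^s_k} + M_{dh_k}`, cuts `M_{h_k}M_{χ_k} = M_{h_k}`, overlap `N_ov`, `2σ ≤ δ`,
`N_ov|κ|²(θ₀ + ε)c_r < 1` ⟹ `glueInvL (R̃ − Σ_kM_{h_k}Ẽ_k) (Σ_kM_{h_k}G_kM_{h_k}) ∘ E ≤ (1 − N_ov(|κ|²θ₀ + |κ|²ε)c_r)⁻¹·N_ov(|κ|²β₂c_s + |κ|²βc_d)·c_r·e^{−(δ−2σ)d}`.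
[cite: Balaban1985BackgroundPropagators, (3.34)–(3.35) p.396, (3.42) p.397 (entry `G∇*_U`), (3.87) p.409; Balaban1984PropagatorsII, (2.91)–(2.93) p.239, (2.133)–(2.136) p.247 (shapes + mechanism, transposed)] -/
theorem hasMaj_gluedL_comp_of_localGauges (htri : Triangle254 g) (hd : ∀ a b : g.Site, 0 ≤ g.dist a b) (hd0 : ∀ y : g.Site, g.dist y y = 0) (hrow : RowSum g σ cr) (hσ : 0 ≤ σ)
    (hW : ∀ k x, W k x * (W k x)ᵀ = 1) (hW' : ∀ k x, (W k x)ᵀ * W k x = 1) {dh : K → X → ℝ} {β β₂ cs cd θ₀ ε δ Nov : ℝ} (hβ : 0 ≤ β) (hβ₂ : 0 ≤ β₂) (hcs : 0 ≤ cs) (hcd : 0 ≤ cd)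
    (hθ : 0 ≤ θ₀) (hε : 0 ≤ ε) (hNov : 0 ≤ Nov) (hσδ : 2 * σ ≤ δ)
    (hleib : ∀ k, mulOp (fun p : X × κ => hX k p.1) ∘ₗ E = E ∘ₗ mulOp (fun p : X × κ => hs k p.1) + mulOp (fun p : X × κ => dh k p.1))
    (hcut : ∀ k, mulOp (fun p : X × κ => hX k p.1) ∘ₗ mulOp (fun p : X × κ => χX k p.1) = mulOp (fun p : X × κ => hX k p.1))
    (hE2' : ∀ k, mulOp (fun p : X × κ => χX k p.1) ∘ₗ G' k ∘ₗ (mmulOp (W k) ∘ₗ E ∘ₗ mmulOp (fun x => (W k x)ᵀ)) ∘ₗ mulOp (fun p : X × κ => hs k p.1) = T' k ∘ₗ mulOp (fun p : X × κ => hs k p.1))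
    (hh : ∀ k x, |hX k x| ≤ 1) (hhs : ∀ k x, |hs k x| ≤ cs) (hdh : ∀ k x, |dh k x| ≤ cd) (hN : ∀ a, ∑ k, ind (S k) a ≤ Nov)
    (hGc' : ∀ k, HasMaj (BlockNorm.ofBlocks g (liftBlk blk κ)) (BlockNorm.ofBlocks g (liftBlk blk κ)) (mulOp (fun p : X × κ => χX k p.1) ∘ₗ G' k)
      (fun y y' => ind (S k) y * ind (S k) y' * (β * Real.exp (-(δ * g.dist y y')))))
    (hT' : ∀ k, HasMaj (BlockNorm.ofBlocks g (liftBlk blk κ)) (BlockNorm.ofBlocks g (liftBlk blk κ)) (T' k) (fun y y' => ind (S k) y * ind (S k) y' * (β₂ * Real.exp (-(δ * g.dist y y')))))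
    (hK' : ∀ k, HasMaj (BlockNorm.ofBlocks g (liftBlk blk κ)) (BlockNorm.ofBlocks g (liftBlk blk κ))
      (G' k ∘ₗ commOp (mmulOp (W k) ∘ₗ Δ ∘ₗ mmulOp (fun x => (W k x)ᵀ)) (fun p : X × κ => hX k p.1)) (fun y y' => ind (S k) y * (θ₀ * Real.exp (-(δ * g.dist y y')))))
    (hEd' : ∀ k, HasMaj (BlockNorm.ofBlocks g (liftBlk blk κ)) (BlockNorm.ofBlocks g (liftBlk blk κ)) (E' k) (fun y y' => ind (S k) y * ind (S k) y' * (ε * Real.exp (-(δ * g.dist y y')))))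
    (hq : Nov * ((Fintype.card κ : ℝ) ^ 2 * θ₀ + (Fintype.card κ : ℝ) ^ 2 * ε) * cr < 1) :
    HasMaj (BlockNorm.ofBlocks g (liftBlk blk κ)) (BlockNorm.ofBlocks g (liftBlk blk κ))
      (glueInvL (remainderL Δ (fun k => fun p : X × κ => hX k p.1) (fun k => mmulOp (fun x => (W k x)ᵀ) ∘ₗ G' k ∘ₗ mmulOp (W k)) -
          ∑ k, mulOp (fun p : X × κ => hX k p.1) ∘ₗ (mmulOp (fun x => (W k x)ᵀ) ∘ₗ E' k ∘ₗ mmulOp (W k)))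
        (parametrix (fun k => fun p : X × κ => hX k p.1) (fun k => mmulOp (fun x => (W k x)ᵀ) ∘ₗ G' k ∘ₗ mmulOp (W k))) ∘ₗ E)
      (fun y y' => (1 - Nov * ((Fintype.card κ : ℝ) ^ 2 * θ₀ + (Fintype.card κ : ℝ) ^ 2 * ε) * cr)⁻¹ * (Nov * ((Fintype.card κ : ℝ) ^ 2 * β₂ * cs + (Fintype.card κ : ℝ) ^ 2 * β * cd)) * cr *
        Real.exp (-((δ - 2 * σ) * g.dist y y'))) :=
  hasMaj_glueInvL_parametrix_comp_cut_of_defect_out (liftBlk blk κ) S htri hd hd0 hrow hσ (by positivity) (by positivity) hcs hcd (by positivity) (by positivity) hNov hσδ hleib hcut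
    (fun k => sandwichR_of_localGauge W E χX hs G' T' hW' k (hE2' k)) (fun k p => hh k p.1) (fun k p => hhs k p.1) (fun k p => hdh k p.1) hN
    (fun k => cutRow_of_localGauge blk S W χX G' hW hW' hβ k (hGc' k)) (fun k => sandwichRow_of_localGauge blk S W T' hW hW' hβ₂ k (hT' k))
    (fun k => commRowR_of_localGauge blk S W Δ hX G' hW hW' hθ k (hK' k)) (fun k => defectRow₂_of_localGauge blk S W E' hW hW' hε k (hEd' k)) hq

/-- ★★★ **… AND THE ADJOINT GLUED OPERATOR IS A TWO-SIDED INVERSE OF THE GLOBAL OPERATOR** — FILE 147 `glued_adjoint_inverse_of_defect` with the right-locality identities, the adjoint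
commutator rows and the defect rows given IN THE CUBES' GAUGES: `Σ_kh_k² = 1`, `G′_k∘Δ^{W_k}∘M_{h_k} = M_{h_k} + Ẽ′_k`, rows as above, `N_ov|κ|²(θ₀ + ε)c_r < 1`, `σ ≤ δ` ⟹ `𝒢∘Δ = 1 ∧ Δ∘𝒢 = 1`
for `𝒢 = glueInvL (R̃ − Σ_kM_{h_k}Ẽ_k) (Σ_kM_{h_k}G_kM_{h_k})` — so by FILE 147 `glueInvL_eq_of_lap_comp` it EQUALS any right inverse of `Δ` (the direct-glued `cvGlued`).
[cite: Balaban1985BackgroundPropagators, (3.34)–(3.35) p.396, (3.87) p.409, Cor. 3.6 p.408 (mechanism); Balaban1984PropagatorsII, (2.91) p.239, (2.135)–(2.136) p.247 (transposed)] -/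
theorem gluedL_inverse_of_localGauges (hd : ∀ a b : g.Site, 0 ≤ g.dist a b) (hrow : RowSum g σ cr) (hW : ∀ k x, W k x * (W k x)ᵀ = 1) (hW' : ∀ k x, (W k x)ᵀ * W k x = 1)
    {θ₀ ε δ Nov : ℝ} (hθ : 0 ≤ θ₀) (hε : 0 ≤ ε) (hNov : 0 ≤ Nov) (hσδ : σ ≤ δ) (h236 : ∀ p : X × κ, ∑ k, (fun p : X × κ => hX k p.1) p ^ 2 = 1)
    (hloc' : ∀ k, G' k ∘ₗ (mmulOp (W k) ∘ₗ Δ ∘ₗ mmulOp (fun x => (W k x)ᵀ)) ∘ₗ mulOp (fun p : X × κ => hX k p.1) = mulOp (fun p : X × κ => hX k p.1) + E' k)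
    (hh : ∀ k x, |hX k x| ≤ 1) (hN : ∀ a, ∑ k, ind (S k) a ≤ Nov)
    (hK' : ∀ k, HasMaj (BlockNorm.ofBlocks g (liftBlk blk κ)) (BlockNorm.ofBlocks g (liftBlk blk κ))
      (G' k ∘ₗ commOp (mmulOp (W k) ∘ₗ Δ ∘ₗ mmulOp (fun x => (W k x)ᵀ)) (fun p : X × κ => hX k p.1)) (fun y y' => ind (S k) y * (θ₀ * Real.exp (-(δ * g.dist y y')))))
    (hEd' : ∀ k, HasMaj (BlockNorm.ofBlocks g (liftBlk blk κ)) (BlockNorm.ofBlocks g (liftBlk blk κ)) (E' k) (fun y y' => ind (S k) y * ind (S k) y' * (ε * Real.exp (-(δ * g.dist y y')))))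
    (hq : Nov * ((Fintype.card κ : ℝ) ^ 2 * θ₀ + (Fintype.card κ : ℝ) ^ 2 * ε) * cr < 1) :
    glueInvL (remainderL Δ (fun k => fun p : X × κ => hX k p.1) (fun k => mmulOp (fun x => (W k x)ᵀ) ∘ₗ G' k ∘ₗ mmulOp (W k)) -
          ∑ k, mulOp (fun p : X × κ => hX k p.1) ∘ₗ (mmulOp (fun x => (W k x)ᵀ) ∘ₗ E' k ∘ₗ mmulOp (W k)))
        (parametrix (fun k => fun p : X × κ => hX k p.1) (fun k => mmulOp (fun x => (W k x)ᵀ) ∘ₗ G' k ∘ₗ mmulOp (W k))) ∘ₗ Δ = LinearMap.id ∧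
      Δ ∘ₗ glueInvL (remainderL Δ (fun k => fun p : X × κ => hX k p.1) (fun k => mmulOp (fun x => (W k x)ᵀ) ∘ₗ G' k ∘ₗ mmulOp (W k)) -
          ∑ k, mulOp (fun p : X × κ => hX k p.1) ∘ₗ (mmulOp (fun x => (W k x)ᵀ) ∘ₗ E' k ∘ₗ mmulOp (W k)))
        (parametrix (fun k => fun p : X × κ => hX k p.1) (fun k => mmulOp (fun x => (W k x)ᵀ) ∘ₗ G' k ∘ₗ mmulOp (W k))) = LinearMap.id :=
  glued_adjoint_inverse_of_defect (liftBlk blk κ) hd hrow (mul_nonneg hNov (by positivity)) hσδ h236 (fun k => hlocR_defect_glue_of_localGauge W Δ hX G' E' hW hW' k (hloc' k))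
    (hasMaj_remainderLD_out (liftBlk blk κ) S (by positivity) (by positivity) (fun k p => hh k p.1) hN
      (fun k => commRowR_of_localGauge blk S W Δ hX G' hW hW' hθ k (hK' k)) (fun k => defectRow₂_of_localGauge blk S W E' hW hW' hε k (hEd' k))) hq

end Glue

end Summit.QuantumFields.YangMills.BalabanUVNodes.N15.Gluing

end
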